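import Summits.CriticalPhenomena.PercolationContinuityZ3.Theorems.PercNearOneGluingNoHeavyLowerTailStarSetLinkGluing
import HarnessLib

/-!
# `NoHeavyLowerTail` (stmt-CriticalPhenomena-4575) — pointwise facts for the FOREST certificate of a two-port star family (level `j ≤ 2`)

Support file (prover `prim-gen-swap` gen 7; `--supports stmt-CriticalPhenomena-4575`).  No definitions, no named facts, no sorries; Mathlib +
`Literature.Probability.Percolation.Percolation` (via …StarSetLinkGluing) only.

Stars `i : Fin m` with ports `p i ≠ p' i ∈ A` (ports of different stars MAY coincide); a configuration `ω` (the configuration off the stars);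
links `L_σ = {s(p k, p' k) : k ∈ σ}`.  Star `i` is LONELY-CAPABLE in `ω` if the relays joined to `p i` or `p' i` number at most `j ≤ 2`
(then they are exactly `p i, p' i` and `j = 2`); it is of TYPE A if `p i ↮_ω p' i` and of TYPE B if `p i ↔_ω p' i` (seat memo R3-SEATS.md §9).

* `StarSet.lonely_pair_relays` — a lonely-capable star sees only its own two ports, and `j = 2`.
* `StarSet.portPattern_lonely_singleton'` — if `1 ≤ |π_ω(P_σ)| ≤ 2` and no two stars of `σ` have the same port pair, `σ` is a singleton.
* `StarSet.lonely_ports_light_adj` — (budget events `E_i`, `F_i`) if no star of `σ` other than `i` shares a port with `i`, both ports of a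
  lonely-capable `i` see at most `j` relays in `ω ∪ L_σ`.
* `StarSet.lonely_port_light_closed` — (budget event `Z`) for a type-A lonely-capable `i`, if no star of `σ` contains `p i`, then `p i` sees at
  most `j` relays in `ω ∪ L_σ`.
* `StarSet.lonely_types_exclusive` — a type-A and a type-B lonely-capable star never share a port.
* `StarSet.lonely_typeB_ports_subset` — if a type-B lonely-capable star `i` shares a port with a lonely-capable star `i'`, both ports of `i`
  are ports of `i'`.
-/

namespace Summit.CriticalPhenomena.PercolationContinuityZ3.Theorems

open Set Literature.Probability.Percolation
open scoped Classical

variable {n m : ℕ}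

namespace StarSet

/-- **A lonely-capable star sees only its two ports.**  If the relays joined in `ω` to `p i` or `p' i` number at most `j ≤ 2`, then every
relay joined to `p i` or to `p' i` is one of them, and `j = 2`. [folklore] -/
theorem lonely_pair_relays (ω : BondConfig (Fin n)) (A : Finset (Fin n)) (p p' : Fin m → Fin n) (i : Fin m) (j : ℕ) (hj : j ≤ 2)
    (hpA : ∀ i, p i ∈ A) (hp'A : ∀ i, p' i ∈ A) (hpp' : ∀ i, p i ≠ p' i)
    (hl : (A.filter fun z => ∃ u ∈ ({i} : Finset (Fin m)).image p ∪ ({i} : Finset (Fin m)).image p',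
      (openGraph ω).Reachable u z).card ≤ j) :
    (∀ z ∈ A, ((openGraph ω).Reachable (p i) z ∨ (openGraph ω).Reachable (p' i) z) → z = p i ∨ z = p' i) ∧ j = 2 := by
  set Q := A.filter fun z => ∃ u ∈ ({i} : Finset (Fin m)).image p ∪ ({i} : Finset (Fin m)).image p',
    (openGraph ω).Reachable u z with hQ
  have hmemQ : ∀ z, z ∈ Q ↔ z ∈ A ∧ ((openGraph ω).Reachable (p i) z ∨ (openGraph ω).Reachable (p' i) z) := by
    intro z
    rw [hQ, Finset.mem_filter]
    simp only [Finset.image_singleton, Finset.mem_union, Finset.mem_singleton]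
    constructor
    · rintro ⟨hzA, u, hu, huz⟩
      rcases hu with rfl | rfl
      · exact ⟨hzA, Or.inl huz⟩
      · exact ⟨hzA, Or.inr huz⟩
    · rintro ⟨hzA, h | h⟩
      · exact ⟨hzA, p i, Or.inl rfl, h⟩
      · exact ⟨hzA, p' i, Or.inr rfl, h⟩
  have hsubQ : ({p i, p' i} : Finset (Fin n)) ⊆ Q := by
    intro x hx
    simp only [Finset.mem_insert, Finset.mem_singleton] at hx
    rcases hx with rfl | rfl
    · exact (hmemQ _).2 ⟨hpA i, Or.inl (SimpleGraph.Reachable.refl _)⟩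
    · exact (hmemQ _).2 ⟨hp'A i, Or.inr (SimpleGraph.Reachable.refl _)⟩
  have hcard2 : ({p i, p' i} : Finset (Fin n)).card = 2 := Finset.card_pair (hpp' i)
  have hle := Finset.card_le_card hsubQ
  have hQeq : ({p i, p' i} : Finset (Fin n)) = Q := Finset.eq_of_subset_of_card_le hsubQ (by omega)
  refine ⟨fun z hzA hz => ?_, by omega⟩
  have hzQ : z ∈ Q := (hmemQ z).2 ⟨hzA, hz⟩
  rw [← hQeq] at hzQ
  simpa only [Finset.mem_insert, Finset.mem_singleton] using hzQ

/-- **Only single-star patterns are lonely (no parallel stars).**  If the relays joined to `P_σ` number between `1` and `j ≤ 2` and no two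
stars of `σ` have the same pair of ports, then `σ` is a singleton. [folklore] -/
theorem portPattern_lonely_singleton' (ω : BondConfig (Fin n)) (A : Finset (Fin n)) (p p' : Fin m → Fin n) (σ : Finset (Fin m))
    (j : ℕ) (hj : j ≤ 2) (hpA : ∀ i, p i ∈ A) (hp'A : ∀ i, p' i ∈ A) (hpp' : ∀ i, p i ≠ p' i)
    (hnopar : ∀ i ∈ σ, ∀ k ∈ σ, i ≠ k → ¬ ((p k = p i ∨ p k = p' i) ∧ (p' k = p i ∨ p' k = p' i)))
    (h1 : 1 ≤ (A.filter fun z => ∃ u ∈ σ.image p ∪ σ.image p', (openGraph ω).Reachable u z).card)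
    (h2 : (A.filter fun z => ∃ u ∈ σ.image p ∪ σ.image p', (openGraph ω).Reachable u z).card ≤ j) :
    ∃ i, σ = {i} := by
  obtain ⟨z, hz⟩ := Finset.card_pos.1 h1
  obtain ⟨-, u, hu, -⟩ := Finset.mem_filter.1 hz
  have hσ : σ.Nonempty := by
    rcases Finset.mem_union.1 hu with hu | hu <;>
    · obtain ⟨i, hi, -⟩ := Finset.mem_image.1 hu; exact ⟨i, hi⟩
  obtain ⟨i, hi⟩ := hσ
  refine ⟨i, Finset.eq_singleton_iff_unique_mem.2 ⟨hi, fun k hk => ?_⟩⟩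
  by_contra hki
  have hmem : ∀ x, (∃ l ∈ σ, x = p l ∨ x = p' l) → x ∈ A →
      x ∈ A.filter fun z => ∃ u ∈ σ.image p ∪ σ.image p', (openGraph ω).Reachable u z := by
    rintro x ⟨l, hl, hx⟩ hxA
    refine Finset.mem_filter.2 ⟨hxA, x, ?_, SimpleGraph.Reachable.refl x⟩
    rcases hx with rfl | rfl
    · exact Finset.mem_union_left _ (Finset.mem_image_of_mem p hl)
    · exact Finset.mem_union_right _ (Finset.mem_image_of_mem p' hl)
  -- `{p i, p' i}` plus one port of `k` not among them: three distinct relays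
  have hnp := hnopar i hi k hk (Ne.symm hki)
  have hthird : ∃ x, (x = p k ∨ x = p' k) ∧ x ≠ p i ∧ x ≠ p' i := by
    by_cases h1 : p k = p i ∨ p k = p' i
    · refine ⟨p' k, Or.inr rfl, fun h => hnp ⟨h1, Or.inl h⟩, fun h => hnp ⟨h1, Or.inr h⟩⟩
    · rw [not_or] at h1
      exact ⟨p k, Or.inl rfl, h1.1, h1.2⟩
  obtain ⟨x, hxk, hx1, hx2⟩ := hthird
  have hxA : x ∈ A := by rcases hxk with rfl | rfl; exacts [hpA k, hp'A k]
  have hsub : ({p i, p' i, x} : Finset (Fin n)) ⊆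
      A.filter fun z => ∃ u ∈ σ.image p ∪ σ.image p', (openGraph ω).Reachable u z := by
    intro y hy
    simp only [Finset.mem_insert, Finset.mem_singleton] at hy
    rcases hy with rfl | rfl | rfl
    · exact hmem _ ⟨i, hi, Or.inl rfl⟩ (hpA i)
    · exact hmem _ ⟨i, hi, Or.inr rfl⟩ (hp'A i)
    · exact hmem _ ⟨k, hk, hxk⟩ hxA
  have hcard : ({p i, p' i, x} : Finset (Fin n)).card = 3 := by
    rw [Finset.card_insert_of_notMem, Finset.card_pair (Ne.symm hx2)]
    simp only [Finset.mem_insert, Finset.mem_singleton, not_or]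
    exact ⟨hpp' i, Ne.symm hx1⟩
  have := Finset.card_le_card hsub
  omega

/-- **Budget events `E_i` / `F_i`.**  If `i` is lonely-capable in `ω` and no star of `σ` other than `i` shares a port with `i`, then both
ports of `i` see at most `j` relays in `ω ∪ L_σ`. [folklore] -/
theorem lonely_ports_light_adj (ω : BondConfig (Fin n)) (A : Finset (Fin n)) (p p' : Fin m → Fin n) (i : Fin m) (σ : Finset (Fin m))
    (j : ℕ) (hj : j ≤ 2) (hpA : ∀ i, p i ∈ A) (hp'A : ∀ i, p' i ∈ A) (hpp' : ∀ i, p i ≠ p' i)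
    (hl : (A.filter fun z => ∃ u ∈ ({i} : Finset (Fin m)).image p ∪ ({i} : Finset (Fin m)).image p',
      (openGraph ω).Reachable u z).card ≤ j)
    (hσ : ∀ k ∈ σ, k ≠ i → ¬ (p k = p i ∨ p k = p' i ∨ p' k = p i ∨ p' k = p' i)) :
    (A.filter fun z => (openGraph (ω ∪ ↑(σ.image fun k => (s(p k, p' k) : Sym2 (Fin n))))).Reachable (p i) z).card ≤ j ∧
      (A.filter fun z => (openGraph (ω ∪ ↑(σ.image fun k => (s(p k, p' k) : Sym2 (Fin n))))).Reachable (p' i) z).card ≤ j := by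
  obtain ⟨hrel, hj2⟩ := lonely_pair_relays ω A p p' i j hj hpA hp'A hpp' hl
  -- the set of vertices joined in `ω` to `p i` or `p' i` is closed under the adjacency of `ω ∪ L_σ`
  have hclosed : ∀ u v, u ∈ {v | (openGraph ω).Reachable (p i) v ∨ (openGraph ω).Reachable (p' i) v} →
      (openGraph (ω ∪ ↑(σ.image fun k => (s(p k, p' k) : Sym2 (Fin n))))).Adj u v →
      v ∈ {v | (openGraph ω).Reachable (p i) v ∨ (openGraph ω).Reachable (p' i) v} := by
    intro u v hu huv
    rw [openGraph_adj, mem_union] at huv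
    obtain ⟨huv, hne⟩ := huv
    rcases huv with hω | hL
    · have hadj : (openGraph ω).Adj u v := by rw [openGraph_adj]; exact ⟨hω, hne⟩
      rcases hu with hu | hu
      · exact Or.inl (hu.trans hadj.reachable)
      · exact Or.inr (hu.trans hadj.reachable)
    · rw [Finset.mem_coe, Finset.mem_image] at hL
      obtain ⟨k, hkσ, hk⟩ := hL
      have huport : u = p k ∨ u = p' k := by
        rcases Sym2.eq_iff.1 hk with ⟨h1, _⟩ | ⟨_, h1⟩
        · exact Or.inl h1.symm
        · exact Or.inr h1.symm
      have hvport : v = p k ∨ v = p' k := by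
        rcases Sym2.eq_iff.1 hk with ⟨_, h2⟩ | ⟨h2, _⟩
        · exact Or.inr h2.symm
        · exact Or.inl h2.symm
      have huA : u ∈ A := by rcases huport with rfl | rfl; exacts [hpA k, hp'A k]
      have hui : u = p i ∨ u = p' i := hrel u huA hu
      by_cases hki : k = i
      · subst hki
        rcases hvport with rfl | rfl
        · exact Or.inl (SimpleGraph.Reachable.refl _)
        · exact Or.inr (SimpleGraph.Reachable.refl _)
      · exfalso
        refine hσ k hkσ hki ?_
        rcases huport with rfl | rfl <;> rcases hui with h | h
        · exact Or.inl h
        · exact Or.inr (Or.inl h)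
        · exact Or.inr (Or.inr (Or.inl h))
        · exact Or.inr (Or.inr (Or.inr h))
  have hbound : ∀ x, x ∈ {v | (openGraph ω).Reachable (p i) v ∨ (openGraph ω).Reachable (p' i) v} →
      (A.filter fun z => (openGraph (ω ∪ ↑(σ.image fun k => (s(p k, p' k) : Sym2 (Fin n))))).Reachable x z).card ≤ j := by
    intro x hx
    have hsub : (A.filter fun z => (openGraph (ω ∪ ↑(σ.image fun k => (s(p k, p' k) : Sym2 (Fin n))))).Reachable x z) ⊆
        ({p i, p' i} : Finset (Fin n)) := by
      intro z hz
      rw [Finset.mem_filter] at hz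
      have hz' := reachable_of_adjClosed (openGraph (ω ∪ ↑(σ.image fun k => (s(p k, p' k) : Sym2 (Fin n)))))
        {v | (openGraph ω).Reachable (p i) v ∨ (openGraph ω).Reachable (p' i) v} hx hclosed hz.2
      rcases hrel z hz.1 hz' with h | h
      · simp [h]
      · simp [h]
    calc _ ≤ ({p i, p' i} : Finset (Fin n)).card := Finset.card_le_card hsub
      _ = 2 := Finset.card_pair (hpp' i)
      _ ≤ j := by omega
  exact ⟨hbound _ (Or.inl (SimpleGraph.Reachable.refl _)), hbound _ (Or.inr (SimpleGraph.Reachable.refl _))⟩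

/-- **Budget event `Z`.**  If `i` is lonely-capable of type A in `ω` (`p i ↮ p' i`) and no star of `σ` has `p i` as a port, then `p i` sees
at most `j` relays in `ω ∪ L_σ`. [folklore] -/
theorem lonely_port_light_closed (ω : BondConfig (Fin n)) (A : Finset (Fin n)) (p p' : Fin m → Fin n) (i : Fin m) (σ : Finset (Fin m))
    (j : ℕ) (hj : j ≤ 2) (hpA : ∀ i, p i ∈ A) (hp'A : ∀ i, p' i ∈ A) (hpp' : ∀ i, p i ≠ p' i)
    (hl : (A.filter fun z => ∃ u ∈ ({i} : Finset (Fin m)).image p ∪ ({i} : Finset (Fin m)).image p',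
      (openGraph ω).Reachable u z).card ≤ j)
    (hA : ¬ (openGraph ω).Reachable (p i) (p' i)) (hσ : ∀ k ∈ σ, p k ≠ p i ∧ p' k ≠ p i) :
    (A.filter fun z => (openGraph (ω ∪ ↑(σ.image fun k => (s(p k, p' k) : Sym2 (Fin n))))).Reachable (p i) z).card ≤ j := by
  obtain ⟨hrel, hj2⟩ := lonely_pair_relays ω A p p' i j hj hpA hp'A hpp' hl
  have hclosed : ∀ u v, u ∈ {v | (openGraph ω).Reachable (p i) v} →
      (openGraph (ω ∪ ↑(σ.image fun k => (s(p k, p' k) : Sym2 (Fin n))))).Adj u v →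
      v ∈ {v | (openGraph ω).Reachable (p i) v} := by
    intro u v hu huv
    rw [openGraph_adj, mem_union] at huv
    obtain ⟨huv, hne⟩ := huv
    rcases huv with hω | hL
    · have hadj : (openGraph ω).Adj u v := by rw [openGraph_adj]; exact ⟨hω, hne⟩
      exact hu.trans hadj.reachable
    · exfalso
      rw [Finset.mem_coe, Finset.mem_image] at hL
      obtain ⟨k, hkσ, hk⟩ := hL
      have huport : u = p k ∨ u = p' k := by
        rcases Sym2.eq_iff.1 hk with ⟨h1, _⟩ | ⟨_, h1⟩
        · exact Or.inl h1.symm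
        · exact Or.inr h1.symm
      have huA : u ∈ A := by rcases huport with rfl | rfl; exacts [hpA k, hp'A k]
      rcases hrel u huA (Or.inl hu) with hui | hui
      · rcases huport with h | h
        · exact (hσ k hkσ).1 (h ▸ hui)
        · exact (hσ k hkσ).2 (h ▸ hui)
      · exact hA (hui ▸ hu)
  have hsub : (A.filter fun z => (openGraph (ω ∪ ↑(σ.image fun k => (s(p k, p' k) : Sym2 (Fin n))))).Reachable (p i) z) ⊆
      ({p i} : Finset (Fin n)) := by
    intro z hz
    rw [Finset.mem_filter] at hz
    have hz' : (openGraph ω).Reachable (p i) z :=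
      reachable_of_adjClosed (openGraph (ω ∪ ↑(σ.image fun k => (s(p k, p' k) : Sym2 (Fin n)))))
        {v | (openGraph ω).Reachable (p i) v} (x := p i) (SimpleGraph.Reachable.refl _) hclosed hz.2
    rcases hrel z hz.1 (Or.inl hz') with h | h
    · simp [h]
    · exact absurd (h ▸ hz') hA
  calc _ ≤ ({p i} : Finset (Fin n)).card := Finset.card_le_card hsub
    _ = 1 := Finset.card_singleton _
    _ ≤ j := by omega

/-- **Types A and B never share a port.**  A type-A lonely-capable star `k` (`p k ↮ p' k`) and a type-B lonely-capable star `i`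
(`p i ↔ p' i`) have no common port. [folklore] -/
theorem lonely_types_exclusive (ω : BondConfig (Fin n)) (A : Finset (Fin n)) (p p' : Fin m → Fin n) (k i : Fin m) (j : ℕ)
    (hj : j ≤ 2) (hpA : ∀ i, p i ∈ A) (hp'A : ∀ i, p' i ∈ A) (hpp' : ∀ i, p i ≠ p' i)
    (hlk : (A.filter fun z => ∃ u ∈ ({k} : Finset (Fin m)).image p ∪ ({k} : Finset (Fin m)).image p',
      (openGraph ω).Reachable u z).card ≤ j)
    (hAk : ¬ (openGraph ω).Reachable (p k) (p' k)) (hBi : (openGraph ω).Reachable (p i) (p' i))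
    (hadj : p k = p i ∨ p k = p' i ∨ p' k = p i ∨ p' k = p' i) : False := by
  obtain ⟨hrel, -⟩ := lonely_pair_relays ω A p p' k j hj hpA hp'A hpp' hlk
  -- a port `a` of `k` equals a port of `i`; the other port `b` of `i` is joined to `a`, hence is a port of `k`, hence `p k ↔ p' k`
  have key : ∀ a b : Fin n, (a = p k ∨ a = p' k) → b ∈ A → a ≠ b → (openGraph ω).Reachable a b → False := by
    intro a b ha hb hab hreach
    have hb' : (openGraph ω).Reachable (p k) b ∨ (openGraph ω).Reachable (p' k) b := by
      rcases ha with rfl | rfl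
      · exact Or.inl hreach
      · exact Or.inr hreach
    rcases ha with rfl | rfl <;> rcases hrel b hb hb' with rfl | rfl
    · exact hab rfl
    · exact hAk hreach
    · exact hAk hreach.symm
    · exact hab rfl
  rcases hadj with h | h | h | h
  · exact key (p k) (p' i) (Or.inl rfl) (hp'A i) (by rw [h]; exact hpp' i) (by rw [h]; exact hBi)
  · exact key (p k) (p i) (Or.inl rfl) (hpA i) (by rw [h]; exact (hpp' i).symm) (by rw [h]; exact hBi.symm)
  · exact key (p' k) (p' i) (Or.inr rfl) (hp'A i) (by rw [h]; exact hpp' i) (by rw [h]; exact hBi)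
  · exact key (p' k) (p i) (Or.inr rfl) (hpA i) (by rw [h]; exact (hpp' i).symm) (by rw [h]; exact hBi.symm)

/-- **A type-B lonely star swallows its lonely neighbours' ports.**  If `i` is lonely-capable of type B (`p i ↔ p' i`), `i'` is lonely-capable,
and they share a port, then both ports of `i` are ports of `i'`. [folklore] -/
theorem lonely_typeB_ports_subset (ω : BondConfig (Fin n)) (A : Finset (Fin n)) (p p' : Fin m → Fin n) (i i' : Fin m) (j : ℕ)
    (hj : j ≤ 2) (hpA : ∀ i, p i ∈ A) (hp'A : ∀ i, p' i ∈ A) (hpp' : ∀ i, p i ≠ p' i)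
    (hli' : (A.filter fun z => ∃ u ∈ ({i'} : Finset (Fin m)).image p ∪ ({i'} : Finset (Fin m)).image p',
      (openGraph ω).Reachable u z).card ≤ j)
    (hBi : (openGraph ω).Reachable (p i) (p' i))
    (hadj : p i = p i' ∨ p i = p' i' ∨ p' i = p i' ∨ p' i = p' i') :
    (p i = p i' ∨ p i = p' i') ∧ (p' i = p i' ∨ p' i = p' i') := by
  obtain ⟨hrel, -⟩ := lonely_pair_relays ω A p p' i' j hj hpA hp'A hpp' hli'
  -- both ports of `i` are joined to the shared port, which is a port of `i'`
  have key : ∀ a : Fin n, (a = p i' ∨ a = p' i') → (openGraph ω).Reachable a (p i) → (openGraph ω).Reachable a (p' i) →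
      (p i = p i' ∨ p i = p' i') ∧ (p' i = p i' ∨ p' i = p' i') := by
    intro a ha h1 h2
    have h1' : (openGraph ω).Reachable (p i') (p i) ∨ (openGraph ω).Reachable (p' i') (p i) := by
      rcases ha with rfl | rfl
      · exact Or.inl h1
      · exact Or.inr h1
    have h2' : (openGraph ω).Reachable (p i') (p' i) ∨ (openGraph ω).Reachable (p' i') (p' i) := by
      rcases ha with rfl | rfl
      · exact Or.inl h2
      · exact Or.inr h2
    exact ⟨hrel _ (hpA i) h1', hrel _ (hp'A i) h2'⟩
  rcases hadj with h | h | h | h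
  · exact key (p i) (Or.inl h) (SimpleGraph.Reachable.refl _) hBi
  · exact key (p i) (Or.inr h) (SimpleGraph.Reachable.refl _) hBi
  · exact key (p' i) (Or.inl h) hBi.symm (SimpleGraph.Reachable.refl _)
  · exact key (p' i) (Or.inr h) hBi.symm (SimpleGraph.Reachable.refl _)

end StarSet

end Summit.CriticalPhenomena.PercolationContinuityZ3.Theorems
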